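import Summits.Schanuel.Schanuel.Theorems.RootDecomp1KTorsionIndependence

/-!
# RootDecomp1KTorsionCells — §21 REV C «TORSION CELLS» port, part 5/5 (lens 6, gen 10 = ROUND 5 theorem round of route-Schanuel-RootDecomp1K on A₄ʰ stmt-Schanuel-33363)

Mechanical port (census-1 gen 8; tools tools/build_dark.py over census/tools/gen7/portkit2.py) of §21 of HOME/decomp-schanuel-lens-6/g10/addendum/TorsionCells.lean v2 (= scratch/Tor21.lean without its copied toolkit)
(sha256 b430567a…, 9025 l; critic VERDICT 2026-08-30T16:25:54Z ACCEPTED — amended F2⁗-1K (i) MET by the sub-class «torsion anchor»; census C-6) on top of the §17 wave Theorems/RootDecomp1KHyper01…19.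
This part: node lines 2057–8995 (8 declarations: mem_adjoin_SFset_I_of_mul_I', hyperCell_twoPiI_any, hyperCell_twoPiI_any_live, hyperLiouvilleSchanuel_live_at_torsionCell, HyperLiouville.rat_mul, sb_torsion_of_mem …).
No named fact, no hypothesis (only tree-proved inputs);
statements and proofs
are otherwise the node's verbatim, in the wave namespace `Summit.Schanuel.Schanuel.Theorems.RootDecomp1KHyper` (sub-namespace `HyperCell`).
`--supports stmt-Schanuel-33363` (A₄ʰ HyperLiouvilleSchanuel: HYPOTHESIS-FREE decided n = 3 cells (2πi, ρ·2πi, w) and every torsion anchor s·πi (ρ hyper-Liouville), via algebraicIndependent_torsion — only input the tree-proved NW96 Thm 2(2) measure of π). Sorry-free; standard axioms. Nothing here proves Schanuel; rung 0.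
-/

set_option linter.dupNamespace false
set_option linter.unusedSectionVars false

noncomputable section

open Complex IntermediateField Filter Polynomial

namespace Summit.Schanuel.Schanuel.Theorems.RootDecomp1KHyper

variable {n K : ℕ}

section Mv

/-- node: auxiliary statement `mem_adjoin_SFset_I_of_mul_I'` (lens 6 gen 10 node, ported verbatim). -/
theorem mem_adjoin_SFset_I_of_mul_I' {N : ℕ} {z : Fin N → ℂ} {x : ℂ} (hx : x * I ∈ SFset z) :
    x ∈ adjoin ℚ (SFset z ∪ {I}) := by
  have hmem1 : x * I ∈ adjoin ℚ (SFset z ∪ {I}) := subset_adjoin ℚ _ (Or.inl hx)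
  have hmemI : I ∈ adjoin ℚ (SFset z ∪ {I}) := subset_adjoin ℚ _ (Or.inr rfl)
  have e : x = -(x * I * I) := by rw [mul_assoc, I_mul_I]; ring
  rw [e]
  exact neg_mem (mul_mem hmem1 hmemI)

end Mv

namespace HyperCell

variable {n K : ℕ}

/-- **TORSION CELL, level 3 (kernel, HYPOTHESIS-FREE).** For a hyper-Liouville real `ρ` and ANY `w`,
the triple `z = (2πi, ρ·2πi, w)` is `HyperLinLiouville` and satisfies Schanuel's bound `SB 3 z`:
`ℚ(z, e^z, i) ∋ ρ = z₁/z₀, π = z₀/(2i), e^{2πiρ} = e^{z₁}`, and these three are algebraically independent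
(`algebraicIndependent_torsion`).  For `w ∉ ℚ·2πi + ℚ·ρ2πi` the triple is ℚ-free: a member of A₄ʰ's scope
at `n = 3` outside every LW-storey and every classical-anchor cell of §17k–§20. -/
theorem hyperCell_twoPiI_any {ρ : ℝ} (hρ : HyperLiouville ρ) (w : ℂ) :
    HyperLinLiouville ![2 * (Real.pi : ℂ) * I, (ρ : ℂ) * (2 * (Real.pi : ℂ) * I), w] ∧
      SB 3 ![2 * (Real.pi : ℂ) * I, (ρ : ℂ) * (2 * (Real.pi : ℂ) * I), w] := by
  have hπ0 : (Real.pi : ℂ) ≠ 0 := ofReal_ne_zero.mpr Real.pi_ne_zero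
  have ht0 : 2 * (Real.pi : ℂ) * I ≠ 0 := mul_ne_zero (mul_ne_zero two_ne_zero hπ0) I_ne_zero
  refine ⟨?_, ?_⟩
  · refine hyperLinLiouville_of_prefix (k := 2) (by omega) ?_
    have h2 : (fun i : Fin 2 =>
        (![2 * (Real.pi : ℂ) * I, (ρ : ℂ) * (2 * (Real.pi : ℂ) * I), w] : Fin 3 → ℂ)
          (Fin.castLE (show 2 ≤ 3 by omega) i)) =
        ![2 * (Real.pi : ℂ) * I, (ρ : ℂ) * (2 * (Real.pi : ℂ) * I)] := by
      funext i; fin_cases i <;> rfl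
    rw [h2]; exact hyperLinLiouville_of_hyperLiouville_ratio hρ _
  · have hz0 : 2 * (Real.pi : ℂ) * I ∈
        adjoin ℚ (SFset ![2 * (Real.pi : ℂ) * I, (ρ : ℂ) * (2 * (Real.pi : ℂ) * I), w] ∪ {I}) :=
      mem_adjoin_SFset_I' (Or.inl ⟨0, rfl⟩)
    have hz1 : (ρ : ℂ) * (2 * (Real.pi : ℂ) * I) ∈
        adjoin ℚ (SFset ![2 * (Real.pi : ℂ) * I, (ρ : ℂ) * (2 * (Real.pi : ℂ) * I), w] ∪ {I}) :=
      mem_adjoin_SFset_I' (Or.inl ⟨1, rfl⟩)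
    have he1 : cexp ((ρ : ℂ) * (2 * (Real.pi : ℂ) * I)) ∈
        adjoin ℚ (SFset ![2 * (Real.pi : ℂ) * I, (ρ : ℂ) * (2 * (Real.pi : ℂ) * I), w] ∪ {I}) :=
      mem_adjoin_SFset_I' (Or.inr ⟨1, rfl⟩)
    have h2π : 2 * (Real.pi : ℂ) ∈
        adjoin ℚ (SFset ![2 * (Real.pi : ℂ) * I, (ρ : ℂ) * (2 * (Real.pi : ℂ) * I), w] ∪ {I}) :=
      mem_adjoin_SFset_I_of_mul_I' (Or.inl ⟨0, rfl⟩)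
    have h2 : (2 : ℂ) ∈
        adjoin ℚ (SFset ![2 * (Real.pi : ℂ) * I, (ρ : ℂ) * (2 * (Real.pi : ℂ) * I), w] ∪ {I}) := by
      exact_mod_cast IntermediateField.natCast_mem _ 2
    have hπ : (Real.pi : ℂ) ∈
        adjoin ℚ (SFset ![2 * (Real.pi : ℂ) * I, (ρ : ℂ) * (2 * (Real.pi : ℂ) * I), w] ∪ {I}) := by
      have hdiv := div_mem h2π h2
      rwa [mul_div_cancel_left₀ _ (two_ne_zero' ℂ)] at hdiv
    have hρmem : (ρ : ℂ) ∈
        adjoin ℚ (SFset ![2 * (Real.pi : ℂ) * I, (ρ : ℂ) * (2 * (Real.pi : ℂ) * I), w] ∪ {I}) := by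
      have hdiv := div_mem hz1 hz0
      rwa [mul_div_assoc, div_self ht0, mul_one] at hdiv
    have hE : cexp (2 * Real.pi * I * ρ) ∈
        adjoin ℚ (SFset ![2 * (Real.pi : ℂ) * I, (ρ : ℂ) * (2 * (Real.pi : ℂ) * I), w] ∪ {I}) := by
      have e : cexp (2 * Real.pi * I * ρ) = cexp ((ρ : ℂ) * (2 * (Real.pi : ℂ) * I)) := by
        congr 1; ring
      rw [e]; exact he1
    refine sb_of_algebraicIndependent (algebraicIndependent_torsion hρ) (by simp) fun j => ?_
    fin_cases j
    · exact hρmem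
    · exact hπ
    · exact hE

/-- The torsion cell in the LIVE TEXT of the route file (the body of A₄ʰ, 33363, at `n = 3`,
`z = (2πi, ρ·2πi, w)`), with A₄ʰ's hypotheses not even used. -/
theorem hyperCell_twoPiI_any_live {ρ : ℝ} (hρ : HyperLiouville ρ) (w : ℂ) :
    (3 : Cardinal) ≤ Algebra.trdeg ℚ ↥(IntermediateField.adjoin ℚ
      (Set.range ![2 * (Real.pi : ℂ) * I, (ρ : ℂ) * (2 * (Real.pi : ℂ) * I), w] ∪
        Set.range (Complex.exp ∘ ![2 * (Real.pi : ℂ) * I, (ρ : ℂ) * (2 * (Real.pi : ℂ) * I), w]))) :=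
  (hyperCell_twoPiI_any hρ w).2

/-- The instance of A₄ʰ's body (live text, `n = 3`) at the torsion cells — both hypotheses idle. -/
theorem hyperLiouvilleSchanuel_live_at_torsionCell {ρ : ℝ} (hρ : HyperLiouville ρ) (w : ℂ) :
    LinearIndependent ℚ ![2 * (Real.pi : ℂ) * I, (ρ : ℂ) * (2 * (Real.pi : ℂ) * I), w] →
    (∀ m : ℕ, ∃ h : Fin 3 → ℤ, h ≠ 0 ∧
      ‖∑ i, (h i : ℂ) * ![2 * (Real.pi : ℂ) * I, (ρ : ℂ) * (2 * (Real.pi : ℂ) * I), w] i‖ <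
        Real.exp (-((1 + ∑ i, (|h i| : ℝ)) ^ m))) →
    ((3 : ℕ) : Cardinal) ≤ Algebra.trdeg ℚ ↥(IntermediateField.adjoin ℚ
      (Set.range ![2 * (Real.pi : ℂ) * I, (ρ : ℂ) * (2 * (Real.pi : ℂ) * I), w] ∪
        Set.range (Complex.exp ∘ ![2 * (Real.pi : ℂ) * I, (ρ : ℂ) * (2 * (Real.pi : ℂ) * I), w]))) :=
  fun _ _ => (hyperCell_twoPiI_any hρ w).2

/-- Hyper-Liouville reals are stable under multiplication by a non-zero rational (`den(s r)` is within
the constant factors `den s`, `den s⁻¹` of `den r`, and one extra power of `q` absorbs them). -/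
theorem HyperLiouville.rat_mul {ρ : ℝ} (hρ : HyperLiouville ρ) {s : ℚ} (hs : s ≠ 0) :
    HyperLiouville ((s : ℝ) * ρ) := by
  intro m
  obtain ⟨c, hc⟩ : ∃ c : ℕ, c = (s⁻¹).den := ⟨_, rfl⟩
  obtain ⟨D, hD⟩ : ∃ D : ℕ, D = s.den := ⟨_, rfl⟩
  have hc1 : 1 ≤ c := by rw [hc]; exact (s⁻¹).den_pos
  have hD1 : 1 ≤ D := by rw [hD]; exact s.den_pos
  obtain ⟨r, hden, hρr, hη⟩ := hρ (max (m + 1) (max (m * c) (D ^ m + ⌈|(s : ℝ)|⌉₊ + 1)))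
  refine ⟨s * r, ?_, ?_, ?_⟩
  · have h1 : r.den ∣ c * (s * r).den := by
      have := Rat.mul_den_dvd s⁻¹ (s * r)
      rwa [← mul_assoc, inv_mul_cancel₀ hs, one_mul, ← hc] at this
    have h2 : r.den ≤ c * (s * r).den :=
      Nat.le_of_dvd (Nat.mul_pos (by omega) (s * r).den_pos) h1
    have h3 : m * c ≤ r.den := le_trans (le_trans (le_max_left _ _) (le_max_right _ _)) hden
    have h4 : m * c ≤ c * (s * r).den := h3.trans h2
    rw [mul_comm] at h4
    exact Nat.le_of_mul_le_mul_left h4 (by omega)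
  · push_cast
    intro h
    exact hρr (mul_left_cancel₀ (by exact_mod_cast hs : (s : ℝ) ≠ 0) h)
  · have hq2 : D ^ m + ⌈|(s : ℝ)|⌉₊ + 1 ≤ r.den :=
      le_trans (le_trans (le_max_right _ _) (le_max_right _ _)) hden
    set q : ℝ := (r.den : ℝ) with hq
    have hq1r : (1 : ℝ) ≤ q := by rw [hq]; exact_mod_cast r.den_pos
    have hden' : ((s * r).den : ℝ) ≤ D * q := by
      rw [hD, hq]
      exact_mod_cast Nat.le_of_dvd (Nat.mul_pos s.den_pos r.den_pos) (Rat.mul_den_dvd s r)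
    have e : (s : ℝ) * ρ - ((s * r : ℚ) : ℝ) = (s : ℝ) * (ρ - r) := by push_cast; ring
    rw [e, abs_mul]
    have h1 : |(s : ℝ)| * |ρ - r| ≤ Real.exp (|(s : ℝ)|) * Real.exp (-(q ^ (m + 1))) := by
      refine mul_le_mul (by linarith [Real.add_one_le_exp (|(s : ℝ)|)]) ?_ (abs_nonneg _)
        (Real.exp_pos _).le
      refine hη.le.trans (Real.exp_le_exp.mpr ?_)
      rw [neg_le_neg_iff]
      exact pow_le_pow_right₀ hq1r (le_max_left _ _)
    refine lt_of_le_of_lt h1 ?_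
    rw [← Real.exp_add, Real.exp_lt_exp]
    have h2 : (((s * r).den : ℝ)) ^ m ≤ ((D : ℝ) * q) ^ m :=
      pow_le_pow_left₀ (by positivity) hden' m
    rw [mul_pow] at h2
    have h4 : ((D : ℝ) ^ m + ⌈|(s : ℝ)|⌉₊ + 1) ≤ q := by rw [hq]; exact_mod_cast hq2
    have h5 : |(s : ℝ)| ≤ ⌈|(s : ℝ)|⌉₊ := Nat.le_ceil _
    have hqm : (1 : ℝ) ≤ q ^ m := one_le_pow₀ hq1r
    have h7 : (D : ℝ) ^ m * q ^ m + ((⌈|(s : ℝ)|⌉₊ : ℝ) + 1) * q ^ m ≤ q ^ (m + 1) := by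
      have := mul_le_mul_of_nonneg_right h4 (by positivity : (0 : ℝ) ≤ q ^ m)
      calc (D : ℝ) ^ m * q ^ m + ((⌈|(s : ℝ)|⌉₊ : ℝ) + 1) * q ^ m
          = ((D : ℝ) ^ m + ⌈|(s : ℝ)|⌉₊ + 1) * q ^ m := by ring
        _ ≤ q * q ^ m := this
        _ = q ^ (m + 1) := by ring
    have h8 : ((⌈|(s : ℝ)|⌉₊ : ℝ) + 1) ≤ ((⌈|(s : ℝ)|⌉₊ : ℝ) + 1) * q ^ m :=
      le_mul_of_one_le_right (by positivity) hqm
    linarith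

/-- `SB N z` (N ≤ 3) as soon as `ℚ(z, e^z, i)` contains `ρ', π, e^{2πiρ'}` for a hyper-Liouville `ρ'`. -/
theorem sb_torsion_of_mem {ρ' : ℝ} (hρ' : HyperLiouville ρ') {N : ℕ} (hN : N ≤ 3) {z : Fin N → ℂ}
    (h0 : (ρ' : ℂ) ∈ adjoin ℚ (SFset z ∪ {I})) (h1 : (Real.pi : ℂ) ∈ adjoin ℚ (SFset z ∪ {I}))
    (h2 : cexp (2 * Real.pi * I * ρ') ∈ adjoin ℚ (SFset z ∪ {I})) : SB N z := by
  refine sb_of_algebraicIndependent (algebraicIndependent_torsion hρ') (by simpa using hN) fun j => ?_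
  fin_cases j
  · exact h0
  · exact h1
  · exact h2

/-- **TORSION CELLS at every anchor `t = s·πi`, `s ∈ ℚ^×` (kernel, HYPOTHESIS-FREE).** For a
hyper-Liouville `ρ` and ANY `w`: the pair `(t, ρt)` and the triple `(t, ρt, w)` are `HyperLinLiouville`
and satisfy `SB 2`, `SB 3` respectively — via the torsion triple of `ρ' = (s/2)ρ` (again hyper-Liouville,
`HyperLiouville.rat_mul`): `e^{2πiρ'} = e^{ρt} = exp z₁`, `π = (s π)/s`, `ρ' = (s/2)·z₁/z₀`.  In particular the
LEVEL-2 dark cells of round 5 at the anchors `ℚ^×·πi` no longer need NW 1996 Thm 1. -/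
theorem hyperCell_ratPiI_any {ρ : ℝ} (hρ : HyperLiouville ρ) {s : ℚ} (hs : s ≠ 0) (w : ℂ) :
    HyperLinLiouville ![(s : ℂ) * Real.pi * I, (ρ : ℂ) * ((s : ℂ) * Real.pi * I), w] ∧
      SB 2 ![(s : ℂ) * Real.pi * I, (ρ : ℂ) * ((s : ℂ) * Real.pi * I)] ∧
      SB 3 ![(s : ℂ) * Real.pi * I, (ρ : ℂ) * ((s : ℂ) * Real.pi * I), w] := by
  have hπ0 : (Real.pi : ℂ) ≠ 0 := ofReal_ne_zero.mpr Real.pi_ne_zero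
  have hsC : (s : ℂ) ≠ 0 := by exact_mod_cast hs
  have ht0 : (s : ℂ) * Real.pi * I ≠ 0 := mul_ne_zero (mul_ne_zero hsC hπ0) I_ne_zero
  have hs2 : s / 2 ≠ 0 := div_ne_zero hs two_ne_zero
  have hρ' : HyperLiouville (((s / 2 : ℚ) : ℝ) * ρ) := hρ.rat_mul hs2
  -- the three generators, rewritten in terms of `z`
  have eu0 : ((((s / 2 : ℚ) : ℝ) * ρ : ℝ) : ℂ) = (s : ℂ) / 2 * (ρ : ℂ) := by push_cast; ring
  have eu2 : cexp (2 * Real.pi * I * ((((s / 2 : ℚ) : ℝ) * ρ : ℝ) : ℂ)) =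
      cexp ((ρ : ℂ) * ((s : ℂ) * Real.pi * I)) := by
    congr 1; push_cast; ring
  -- memberships, for a general ambient intermediate field containing `t, ρt, e^{ρt}, i`
  have key : ∀ F : IntermediateField ℚ ℂ, (s : ℂ) * Real.pi * I ∈ F →
      (ρ : ℂ) * ((s : ℂ) * Real.pi * I) ∈ F → cexp ((ρ : ℂ) * ((s : ℂ) * Real.pi * I)) ∈ F → I ∈ F →
      ((((s / 2 : ℚ) : ℝ) * ρ : ℝ) : ℂ) ∈ F ∧ (Real.pi : ℂ) ∈ F ∧
        cexp (2 * Real.pi * I * ((((s / 2 : ℚ) : ℝ) * ρ : ℝ) : ℂ)) ∈ F := by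
    intro F hz0 hz1 he1 hI
    have hsF : (s : ℂ) ∈ F := by
      rw [← eq_ratCast (algebraMap ℚ ℂ) s]; exact F.algebraMap_mem s
    have h2F : (2 : ℂ) ∈ F := by exact_mod_cast IntermediateField.natCast_mem F 2
    have hsπ : (s : ℂ) * Real.pi ∈ F := by
      have e : (s : ℂ) * Real.pi = -((s : ℂ) * Real.pi * I * I) := by
        rw [mul_assoc ((s : ℂ) * Real.pi), I_mul_I]; ring
      rw [e]; exact neg_mem (mul_mem hz0 hI)
    have hπ : (Real.pi : ℂ) ∈ F := by
      have hdiv := div_mem hsπ hsF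
      rwa [mul_div_cancel_left₀ _ hsC] at hdiv
    have hρmem : (ρ : ℂ) ∈ F := by
      have hdiv := div_mem hz1 hz0
      rwa [mul_div_assoc, div_self ht0, mul_one] at hdiv
    refine ⟨?_, hπ, ?_⟩
    · rw [eu0]; exact mul_mem (div_mem hsF h2F) hρmem
    · rw [eu2]; exact he1
  refine ⟨?_, ?_, ?_⟩
  · refine hyperLinLiouville_of_prefix (k := 2) (by omega) ?_
    have h2 : (fun i : Fin 2 =>
        (![(s : ℂ) * Real.pi * I, (ρ : ℂ) * ((s : ℂ) * Real.pi * I), w] : Fin 3 → ℂ)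
          (Fin.castLE (show 2 ≤ 3 by omega) i)) =
        ![(s : ℂ) * Real.pi * I, (ρ : ℂ) * ((s : ℂ) * Real.pi * I)] := by
      funext i; fin_cases i <;> rfl
    rw [h2]; exact hyperLinLiouville_of_hyperLiouville_ratio hρ _
  · obtain ⟨h0, h1, h2⟩ := key (adjoin ℚ (SFset ![(s : ℂ) * Real.pi * I,
        (ρ : ℂ) * ((s : ℂ) * Real.pi * I)] ∪ {I}))
      (mem_adjoin_SFset_I' (Or.inl ⟨0, rfl⟩)) (mem_adjoin_SFset_I' (Or.inl ⟨1, rfl⟩))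
      (mem_adjoin_SFset_I' (Or.inr ⟨1, rfl⟩)) (subset_adjoin ℚ _ (Or.inr rfl))
    exact sb_torsion_of_mem hρ' (by omega) h0 h1 h2
  · obtain ⟨h0, h1, h2⟩ := key (adjoin ℚ (SFset ![(s : ℂ) * Real.pi * I,
        (ρ : ℂ) * ((s : ℂ) * Real.pi * I), w] ∪ {I}))
      (mem_adjoin_SFset_I' (Or.inl ⟨0, rfl⟩)) (mem_adjoin_SFset_I' (Or.inl ⟨1, rfl⟩))
      (mem_adjoin_SFset_I' (Or.inr ⟨1, rfl⟩)) (subset_adjoin ℚ _ (Or.inr rfl))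
    exact sb_torsion_of_mem hρ' le_rfl h0 h1 h2

/-- Live-text form of the pair cell (the body of A₄ʰ at `n = 2`, anchor `s·πi`), hypothesis-free. -/
theorem hyperCell_ratPiI_pair_live {ρ : ℝ} (hρ : HyperLiouville ρ) {s : ℚ} (hs : s ≠ 0) :
    (2 : Cardinal) ≤ Algebra.trdeg ℚ ↥(IntermediateField.adjoin ℚ
      (Set.range ![(s : ℂ) * Real.pi * I, (ρ : ℂ) * ((s : ℂ) * Real.pi * I)] ∪
        Set.range (Complex.exp ∘ ![(s : ℂ) * Real.pi * I, (ρ : ℂ) * ((s : ℂ) * Real.pi * I)]))) :=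
  (hyperCell_ratPiI_any hρ hs 0).2.1

end HyperCell

end Summit.Schanuel.Schanuel.Theorems.RootDecomp1KHyper
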